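import Summits.ResolutionOfSingularities.ResolutionOfSingularities.Theorems.FrobeniusClosingSteerBetaGlueSupport
import Summits.ResolutionOfSingularities.ResolutionOfSingularities.Theorems.FrobeniusClosingSteerBetaVertexMoves
import Summits.ResolutionOfSingularities.ResolutionOfSingularities.Theorems.FrobeniusClosingSteerBetaPreparedTransferY
import Summits.ResolutionOfSingularities.ResolutionOfSingularities.Theorems.FrobeniusClosingSteerBetaGlueTaylor
import HarnessLib

/-!
# Crux `Steer` (stmt-ResolutionOfSingularities-16345), chain W4.1, β-LEAF, K-β2♭ part (III), file G2: the FRAME CORRECTION for the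
# glue `yLetterLawHat_of` — an attaining frame is directrix-normalised modulo `(x) + y·𝔪` (def-free)

OURS (campaign `res-hironaka`, rung L ★L-G4, slot W4.1; statements about the route's own objects; they replace the
role of no printed item and are NOT statements of the manuscript under review [claim: Hironaka2017, status:
under-review]; AI review is weaker than expert review). Seat res-D-pv-003 (gen 7), K-β2♭ owner; GLUE (III) per
res-L0-w41-plan-1 RULING 276(a); FINDING J5-b.

Setting of the `y`-letter glue: a near-point frame `(x, y, z, w)` (`𝐒(f)` in the region `2A + B ≥ 2`, forced downstairs by
`f₁ ∈ 𝔪₁^d`) with cone clause `f ≡ Ψ(z, w)` (`Ψ` rootless, homogeneous of ODD degree `d ≥ 3`), and another frame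
`z′ = z + c₁x + c₂y`, `w′ = w + c₁′x + c₂′y` in which `f′ = f + u q²` satisfies `BetaGe (0, 2)` (as every ATTAINING representative does,
`…BetaGlueSupport`). THEN `c₂, c₂′ ∈ 𝔪` (`frame_yCoeff_mem_maximalIdeal`): the naive `y`-chart transform `φ z′ / φ y` is again a
parameter. Mechanism (characteristic `2`, `d` odd): modulo the monomial ideal `E` of all monomials NOT dividing `y^(d−1)z′` one has
`x ≡ w′ ≡ z′² ≡ y^d ≡ 0`, squares contribute nothing, and the first-order expansion `Ψ(−c₂y + z′, −c₂′y) ≡ z′·y^(d−1)·∂_ZΨ(−c₂, −c₂′)`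
(`…BetaGlueTaylor`) forces `∂_ZΨ(−c₂, −c₂′) ∈ 𝔪`; symmetrically `∂_WΨ(−c₂, −c₂′) ∈ 𝔪`;
EULER (`d ≡ 1`) gives `Ψ(−c₂, −c₂′) ∈ 𝔪`, and rootlessness `c̄₂ = c̄₂′ = 0`.

[cite: CossartJannsenSaito2020, Lemma 12.2 and (7.4)] [cite: CossartPiltant2019, Prop. 2.1] No Theses file is imported; nothing here is
a route item or a registration.
-/

noncomputable section

-- `Summit.<S>.<S>.…` duplicates the summit name by design (single-problem summit).
set_option linter.dupNamespace false

namespace Summit.ResolutionOfSingularities.ResolutionOfSingularities.Theorems.SwitchingDichotomy.BetaNewton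

open IsLocalRing MvPolynomial
open Literature.AlgebraicGeometry.Resolution
open Literature.AlgebraicGeometry.Resolution.CossartPiltant (uPow uPow_mem_span_uPow uPow_mem_span_uPow_of_le minExponents
  uPow_add uPow_single exists_expansion_minExponents coeff_not_mem_of_minimal mem_span_range_of_mul_uPow_mem)
open Summit.ResolutionOfSingularities.ResolutionOfSingularities.Theorems.SwitchingDichotomy.BetaPolygon
open Summit.ResolutionOfSingularities.ResolutionOfSingularities.Theorems.SwitchingDichotomy.BetaLetter
  (uPow_four range_four span_four_pow_eq_span_uPow)

variable {S : Type} [CommRing S]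

/-! ## §2 The cone clause in a near-point frame: `f − Ψ(z, w) ∈ (x) + 𝔪^(d+1)` -/

/-- **In a near-point frame the cone clause sharpens to `f − Ψ(z, w) ∈ (x) + 𝔪^(d+1)`**: the correction term has no monomial
`y^b z^i w^j` of degree `d` with `b ≥ 1` (such a point `(0, b/(b)) = (0, 1)` violates `2A + B ≥ 2`). [folklore] -/
theorem sub_cone_mem_of_nearY [IsLocalRing S] {x y z w : S} (ht : IsRsopPart ![x, y, z, w])
    (hspan : Ideal.span {x, y, z, w} = maximalIdeal S) {d : ℕ} (hd : 0 < d) {Ψ : MvPolynomial (Fin 2) S}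
    (hΨ : Ψ.IsHomogeneous d) {f : S}
    (hfΨ : f - eval ![z, w] Ψ ∈ Ideal.span {x, y} * maximalIdeal S ^ (d - 1) ⊔ maximalIdeal S ^ (d + 1))
    (hnear : ∀ a ∈ minExponents ![x, y, z, w] f, d ≤ a 2 + a 3 ∨ 2 * (d - a 2 - a 3) ≤ 2 * a 0 + a 1) :
    f - eval ![z, w] Ψ ∈ Ideal.span {x} ⊔ maximalIdeal S ^ (d + 1) := by
  set T := f - eval ![z, w] Ψ with hT
  -- `T` lies in the near-point monomial ideal
  have hTG : T ∈ Ideal.span (uPow ![x, y, z, w] '' {e | d ≤ e 2 + e 3 ∨ 2 * (d - e 2 - e 3) ≤ 2 * e 0 + e 1}) := by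
    refine sub_mem (mem_of_forall_minExponents_uPow_mem ht fun c hc => uPow_mem_span_uPow _ (hnear c hc)) ?_
    exact Ideal.span_mono (Set.image_mono fun e he => Or.inl he) (eval_mem_span_uPow_of_isHomogeneous x y z w hΨ)
  -- `T` lies in the monomial ideal of the cone correction
  have hTK : T ∈ Ideal.span (uPow ![x, y, z, w] ''
      {e | d + 1 ≤ ∑ l, e l ∨ (d ≤ ∑ l, e l ∧ (1 ≤ e 0 ∨ 1 ≤ e 1))}) := by
    have hK : Ideal.span {x, y} * maximalIdeal S ^ (d - 1) ⊔ maximalIdeal S ^ (d + 1) ≤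
        Ideal.span (uPow ![x, y, z, w] '' {e | d + 1 ≤ ∑ l, e l ∨ (d ≤ ∑ l, e l ∧ (1 ≤ e 0 ∨ 1 ≤ e 1))}) := by
      refine sup_le ?_ ?_
      · rw [← hspan, span_four_pow_eq_span_uPow, Ideal.span_mul_span', Ideal.span_le]
        rintro _ ⟨s, hs, _, ⟨e, he, rfl⟩, rfl⟩
        simp only [Set.mem_setOf_eq] at he
        show s * uPow ![x, y, z, w] e ∈ _
        simp only [Set.mem_insert_iff, Set.mem_singleton_iff] at hs
        rcases hs with hs | hs
        · have : s * uPow ![x, y, z, w] e = uPow ![x, y, z, w] (e + Pi.single 0 1) := by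
            rw [uPow_add, uPow_single, mul_comm, hs]; rfl
          rw [this]
          refine uPow_mem_span_uPow _ (Or.inr ⟨?_, Or.inl ?_⟩)
          · rw [sum_four] at he ⊢; simp; omega
          · simp
        · have : s * uPow ![x, y, z, w] e = uPow ![x, y, z, w] (e + Pi.single 1 1) := by
            rw [uPow_add, uPow_single, mul_comm, hs]; rfl
          rw [this]
          refine uPow_mem_span_uPow _ (Or.inr ⟨?_, Or.inr ?_⟩)
          · rw [sum_four] at he ⊢; simp; omega
          · simp
      · rw [← hspan, span_four_pow_eq_span_uPow]
        exact Ideal.span_mono (Set.image_mono fun e he => Or.inl he)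
    exact hK hfΨ
  -- hence every minimal exponent of `T` has `e₀ ≥ 1` or degree `≥ d + 1`
  refine mem_of_forall_minExponents_uPow_mem ht fun e he => ?_
  obtain ⟨g, hg, hge⟩ := exists_le_of_mem_span_uPow ht hTG he
  obtain ⟨k, hk, hke⟩ := exists_le_of_mem_span_uPow ht hTK he
  simp only [Set.mem_setOf_eq] at hg hk
  have g0 : g 0 ≤ e 0 := hge 0; have g1 : g 1 ≤ e 1 := hge 1; have g2 : g 2 ≤ e 2 := hge 2; have g3 : g 3 ≤ e 3 := hge 3
  have k0 : k 0 ≤ e 0 := hke 0; have k1 : k 1 ≤ e 1 := hke 1; have k2 : k 2 ≤ e 2 := hke 2; have k3 : k 3 ≤ e 3 := hke 3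
  rw [sum_four] at hk
  by_cases h0 : 1 ≤ e 0
  · -- divisible by `x`
    refine Ideal.mem_sup_left (Ideal.mem_span_singleton'.mpr ⟨uPow ![x, y, z, w] (e - Pi.single 0 1), ?_⟩)
    have : e = (e - Pi.single 0 1) + Pi.single 0 1 := by
      funext l
      obtain rfl | rfl | rfl | rfl : l = 0 ∨ l = 1 ∨ l = 2 ∨ l = 3 := by fin_cases l <;> simp
      · simp; omega
      all_goals simp
    conv_rhs => rw [this, uPow_add, uPow_single]
    simp [mul_comm]
  · refine Ideal.mem_sup_right ?_
    have hdeg : d + 1 ≤ ∑ l, e l := by rw [sum_four]; omega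
    exact Ideal.pow_le_pow_right hdeg (uPow_mem_maximalIdeal_pow hspan e)

/-! ## §3 The first-order coefficient modulo the ideal of monomials not dividing `y^(d−1)·p` -/

/-- **Engine.** In the frame `t′ = (x, y, z′, w′)` let `E` be the monomial ideal of the exponents NOT below `e⋆`, where
`t′^{e⋆} = y^(d−1)·p`, `p² ∈ E`, `y^d ∈ E`. If `Ψ(z, w) ∈ E` with `z ≡ −c₂y + p·δ₀`, `w ≡ −c₂′y + p·δ₁` modulo `E`, then
`δ₀ ∂₀Ψ(−c₂, −c₂′) + δ₁ ∂₁Ψ(−c₂, −c₂′) ∈ 𝔪` (first-order expansion in the square-zero direction `p`). [folklore] -/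
theorem dir_pderiv_eval_mem_maximalIdeal [IsLocalRing S] {x y z' w' : S} (ht' : IsRsopPart ![x, y, z', w'])
    (hspan' : Ideal.span {x, y, z', w'} = maximalIdeal S) {d : ℕ} {Ψ : MvPolynomial (Fin 2) S}
    (hΨ : Ψ.IsHomogeneous d) {estar : Fin 4 → ℕ} {p : S} (hue : uPow ![x, y, z', w'] estar = y ^ (d - 1) * p)
    (hpp : p * p ∈ Ideal.span (uPow ![x, y, z', w'] '' {e | ¬ e ≤ estar}))
    (hyd : y ^ d ∈ Ideal.span (uPow ![x, y, z', w'] '' {e | ¬ e ≤ estar})) {c₂ c₂' z w : S} (δ : Fin 2 → S)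
    (hz : z - (-(c₂ * y) + p * δ 0) ∈ Ideal.span (uPow ![x, y, z', w'] '' {e | ¬ e ≤ estar}))
    (hw : w - (-(c₂' * y) + p * δ 1) ∈ Ideal.span (uPow ![x, y, z', w'] '' {e | ¬ e ≤ estar}))
    (hmem : eval ![z, w] Ψ ∈ Ideal.span (uPow ![x, y, z', w'] '' {e | ¬ e ≤ estar})) :
    δ 0 * eval ![-c₂, -c₂'] (pderiv 0 Ψ) + δ 1 * eval ![-c₂, -c₂'] (pderiv 1 Ψ) ∈ maximalIdeal S := by
  classical
  set E : Ideal S := Ideal.span (uPow ![x, y, z', w'] '' {e | ¬ e ≤ estar}) with hE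
  set D : S := δ 0 * eval ![-c₂, -c₂'] (pderiv 0 Ψ) + δ 1 * eval ![-c₂, -c₂'] (pderiv 1 Ψ) with hD
  set mk : S →+* S ⧸ E := Ideal.Quotient.mk E with hmk
  have hmk0 : ∀ s ∈ E, mk s = 0 := fun s hs => Ideal.Quotient.eq_zero_iff_mem.mpr hs
  have hu : mk p * mk p = 0 := by rw [← map_mul]; exact hmk0 _ hpp
  have hy0 : mk y ^ d = 0 := by rw [← map_pow]; exact hmk0 _ hyd
  -- the point `(z, w)` modulo `E`
  have hptZ : mk z = mk y * mk (-c₂) + mk p * mk (δ 0) := by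
    have h := (Ideal.Quotient.mk_eq_mk_iff_sub_mem _ _).mpr hz
    rw [← hmk] at h
    rw [h, map_add, map_neg, map_mul, map_mul, map_neg]; ring
  have hptW : mk w = mk y * mk (-c₂') + mk p * mk (δ 1) := by
    have h := (Ideal.Quotient.mk_eq_mk_iff_sub_mem _ _).mpr hw
    rw [← hmk] at h
    rw [h, map_add, map_neg, map_mul, map_mul, map_neg]; ring
  have hpt : mk ∘ ![z, w] = (mk y) • ![mk (-c₂), mk (-c₂')] + mk p • ![mk (δ 0), mk (δ 1)] := by
    funext j
    fin_cases j
    · simp [hptZ]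
    · simp [hptW]
  -- evaluate modulo `E`
  have hderiv : ∀ i : Fin 2, eval ((mk y) • ![mk (-c₂), mk (-c₂')]) (pderiv i (MvPolynomial.map mk Ψ)) =
      mk y ^ (d - 1) * mk (eval ![-c₂, -c₂'] (pderiv i Ψ)) := by
    intro i
    rw [eval_smul_of_isHomogeneous ((hΨ.map mk).pderiv), map_eval mk ![-c₂, -c₂'] (pderiv i Ψ), pderiv_map]
    have hcomp : mk ∘ ![-c₂, -c₂'] = ![mk (-c₂), mk (-c₂')] := by funext j; fin_cases j <;> rfl
    rw [hcomp]
  have key : mk (eval ![z, w] Ψ) = mk (p * y ^ (d - 1) * D) := by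
    rw [map_eval mk ![z, w] Ψ, hpt, eval_add_smul_of_mul_self_eq_zero _ _ _ hu, eval_smul_of_isHomogeneous (hΨ.map mk),
      hy0, zero_mul, zero_add]
    simp only [Matrix.cons_val_zero, Matrix.cons_val_one]
    rw [hderiv 0, hderiv 1, hD, map_mul, map_mul, map_pow, map_add, map_mul, map_mul]
    ring
  -- lift back: `D · y^(d−1) · p ∈ E`
  have hprod : D * uPow ![x, y, z', w'] estar ∈ E := by
    rw [hue, ← Ideal.Quotient.eq_zero_iff_mem, ← hmk, map_mul]
    have h0 : mk (eval ![z, w] Ψ) = 0 := hmk0 _ hmem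
    rw [key, map_mul] at h0
    rw [mul_comm, mul_comm (y ^ (d - 1)) p]; exact h0
  have := mem_span_range_of_mul_uPow_mem ![x, y, z', w'] ht'.mem_span_image_of_mul_mem
    (fun b hb hle => (show ¬ b ≤ estar from hb) hle) hprod
  rwa [range_four, hspan'] at this

/-! ## §4 The frame correction -/

/-- Exponents below `e⋆ ∈ {(0, d−1, 1, 0), (0, d−1, 0, 1)}` have `e₀ = 0`, `e₁ ≤ d − 1`, `e₂ + e₃ ≤ 1`; hence (for `d ≥ 3`) no exponent
of degree `≥ d + 1`, no `x`-exponent, no exponent of the `BetaGe (0, 2)` region and no twisted-square exponent of degree `≥ d` lies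
below `e⋆`. The common membership step of the frame correction. [folklore] -/
theorem eval_cone_mem_span_uPow_not_le [IsLocalRing S] [CharP S 2] {x y z w z' w' : S} (ht : IsRsopPart ![x, y, z, w])
    (ht' : IsRsopPart ![x, y, z', w']) (hspan : Ideal.span {x, y, z, w} = maximalIdeal S)
    (hspan' : Ideal.span {x, y, z', w'} = maximalIdeal S) {d : ℕ} (h3 : 3 ≤ d) {Ψ : MvPolynomial (Fin 2) S}
    (hΨ : Ψ.IsHomogeneous d) {f : S}
    (hfΨ : f - eval ![z, w] Ψ ∈ Ideal.span {x, y} * maximalIdeal S ^ (d - 1) ⊔ maximalIdeal S ^ (d + 1))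
    (hnear : ∀ a ∈ minExponents ![x, y, z, w] f, d ≤ a 2 + a 3 ∨ 2 * (d - a 2 - a 3) ≤ 2 * a 0 + a 1)
    {a b : ℕ} {q : S} (hfd' : f + x ^ a * y ^ b * q ^ 2 ∈ maximalIdeal S ^ d)
    (hB : BetaGe x y z' w' d 0 2 (f + x ^ a * y ^ b * q ^ 2)) {estar : Fin 4 → ℕ}
    (hst : ∀ e : Fin 4 → ℕ, e ≤ estar → e 0 = 0 ∧ e 1 ≤ d - 1 ∧ e 2 + e 3 ≤ 1) :
    eval ![z, w] Ψ ∈ Ideal.span (uPow ![x, y, z', w'] '' {e | ¬ e ≤ estar}) := by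
  classical
  have hd : 0 < d := by omega
  have hfd : f ∈ maximalIdeal S ^ d := mem_pow_of_cone hspan hd hΨ hfΨ
  have hT := sub_cone_mem_of_nearY ht hspan hd hΨ hfΨ hnear
  have huq : x ^ a * y ^ b * q ^ 2 ∈ maximalIdeal S ^ d := by
    have : x ^ a * y ^ b * q ^ 2 = (f + x ^ a * y ^ b * q ^ 2) - f := by ring
    rw [this]; exact sub_mem hfd' hfd
  -- degree `≥ d + 1` exponents and `x`-exponents are not below `e⋆`
  have hdeg : ∀ e : Fin 4 → ℕ, d + 1 ≤ ∑ l, e l → ¬ e ≤ estar := by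
    intro e he hle
    obtain ⟨h0, h1, h23⟩ := hst e hle
    rw [sum_four] at he; omega
  have hx0 : ∀ e : Fin 4 → ℕ, 1 ≤ e 0 → ¬ e ≤ estar := by
    intro e he hle
    obtain ⟨h0, -, -⟩ := hst e hle
    omega
  have hTE : f - eval ![z, w] Ψ ∈ Ideal.span (uPow ![x, y, z', w'] '' {e | ¬ e ≤ estar}) := by
    have hle : Ideal.span {x} ⊔ maximalIdeal S ^ (d + 1) ≤ Ideal.span (uPow ![x, y, z', w'] '' {e | ¬ e ≤ estar}) := by
      refine sup_le ?_ ?_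
      · rw [Ideal.span_singleton_le_iff_mem]
        have h := uPow_mem_span_uPow ![x, y, z', w'] (B := {e | ¬ e ≤ estar}) (b := Pi.single 0 1)
          (hx0 (Pi.single 0 1) (by rw [Pi.single_eq_same]))
        simpa [uPow_single] using h
      · rw [← hspan', span_four_pow_eq_span_uPow]
        exact Ideal.span_mono (Set.image_mono fun e he => hdeg e he)
    exact hle hT
  -- the cleaned element: `BetaGe (0, 2)` region
  have hf'E : f + x ^ a * y ^ b * q ^ 2 ∈ Ideal.span (uPow ![x, y, z', w'] '' {e | ¬ e ≤ estar}) := by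
    refine mem_of_forall_minExponents_uPow_mem ht' fun e he => uPow_mem_span_uPow _ ?_
    intro hle
    obtain ⟨h0, h1, h23⟩ := hst e hle
    rcases (betaGe_iff_forall_minExponents ht' le_rfl (by norm_num) _).mp hB e he with h | h | ⟨-, h⟩
    · omega
    · rw [zero_mul, Nat.floor_zero] at h; omega
    · have hc : ⌈(2 : ℚ) * ((d - e 2 - e 3 : ℕ) : ℚ)⌉₊ = 2 * (d - e 2 - e 3) := by
        rw [show (2 : ℚ) * ((d - e 2 - e 3 : ℕ) : ℚ) = ((2 * (d - e 2 - e 3) : ℕ) : ℚ) by push_cast; ring, Nat.ceil_natCast]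
      rw [hc] at h; omega
  -- the twisted square: its minimal exponents are `2c + ε` of degree `≥ d`
  have huqE : x ^ a * y ^ b * q ^ 2 ∈ Ideal.span (uPow ![x, y, z', w'] '' {e | ¬ e ≤ estar}) := by
    obtain ⟨hQ, hqQ, hminQ⟩ := ht'.minExponents_spec q
    obtain ⟨η, hηq⟩ := exists_expansion_minExponents ![x, y, z', w'] hqQ
    have hηu := coeff_not_mem_of_minimal _ hQ hminQ hηq
    have hε : uPow ![x, y, z', w'] ![a, b, 0, 0] = x ^ a * y ^ b := by rw [uPow_four]; simp
    have hexp : x ^ a * y ^ b * q ^ 2 =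
        ∑ c ∈ minExponents ![x, y, z', w'] q, η c ^ 2 * uPow ![x, y, z', w'] (2 • c + ![a, b, 0, 0]) := by
      have h2 := mul_sq_expansion ![x, y, z', w'] (minExponents ![x, y, z', w'] q) η id ![a, b, 0, 0]
      simp only [id] at h2
      rw [← h2, ← hηq, hε]
    refine mem_of_forall_minExponents_uPow_mem ht' fun e he => uPow_mem_span_uPow _ ?_
    have hdege := (mem_pow_iff_forall_minExponents ht' hspan' d _).mp huq e he
    rw [hexp] at he
    obtain ⟨c, -, rfl⟩ := forall_minExponents_sum_sq ht' _ hηu ![a, b, 0, 0] _ he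
    intro hle
    obtain ⟨h0, h1, h23⟩ := hst _ hle
    rw [sum_four] at hdege
    simp only [Pi.add_apply, Pi.smul_apply, smul_eq_mul, Matrix.cons_val_zero, Matrix.cons_val_one,
      Matrix.cons_val] at h0 h1 h23 hdege
    omega
  have : eval ![z, w] Ψ = (f + x ^ a * y ^ b * q ^ 2) - x ^ a * y ^ b * q ^ 2 - (f - eval ![z, w] Ψ) := by ring
  rw [this]
  exact sub_mem (sub_mem hf'E huqE) hTE

/-- **FRAME CORRECTION (J5-b).** In a near-point frame `(x, y, z, w)` with cone clause `f ≡ Ψ(z, w)` (`Ψ` homogeneous of ODD degree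
`d ≥ 3`, rootless), characteristic `2`: if in the frame `z′ = z + c₁x + c₂y`, `w′ = w + c₁′x + c₂′y` some cleaning `f + x^a y^b q²`
(of order `≥ d`) satisfies `BetaGe (0, 2)`, then `c₂, c₂′ ∈ 𝔪`. [cite: CossartJannsenSaito2020, Lemma 12.2 and (7.4)] -/
theorem frame_yCoeff_mem_maximalIdeal [IsLocalRing S] [CharP S 2] (hreg : IsRegularLocalRing S) (hdim : ringKrullDim S = 4)
    {x y z w : S} (hspan : Ideal.span {x, y, z, w} = maximalIdeal S) {d : ℕ} (hodd : Odd d) (h3 : 3 ≤ d)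
    {Ψ : MvPolynomial (Fin 2) S} (hΨ : Ψ.IsHomogeneous d)
    (hroot : ∀ a b : ResidueField S, (a ≠ 0 ∨ b ≠ 0) → eval ![a, b] (MvPolynomial.map (residue S) Ψ) ≠ 0)
    {f : S} (hfΨ : f - eval ![z, w] Ψ ∈ Ideal.span {x, y} * maximalIdeal S ^ (d - 1) ⊔ maximalIdeal S ^ (d + 1))
    (hnear : ∀ a ∈ minExponents ![x, y, z, w] f, d ≤ a 2 + a 3 ∨ 2 * (d - a 2 - a 3) ≤ 2 * a 0 + a 1)
    {z' w' c₁ c₂ c₁' c₂' : S} (hz' : z' = z + c₁ * x + c₂ * y) (hw' : w' = w + c₁' * x + c₂' * y)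
    {a b : ℕ} {q : S} (hfd' : f + x ^ a * y ^ b * q ^ 2 ∈ maximalIdeal S ^ d)
    (hB : BetaGe x y z' w' d 0 2 (f + x ^ a * y ^ b * q ^ 2)) :
    c₂ ∈ maximalIdeal S ∧ c₂' ∈ maximalIdeal S := by
  classical
  haveI := hreg
  -- the frame `t′`
  have hxy : ∀ c c' : S, c * x + c' * y ∈ Ideal.span ({x, y} : Set S) := fun c c' =>
    add_mem (Ideal.mul_mem_left _ _ (Ideal.subset_span (by simp))) (Ideal.mul_mem_left _ _ (Ideal.subset_span (by simp)))
  have hspan' : Ideal.span {x, y, z', w'} = maximalIdeal S := by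
    rw [hz', hw', add_assoc, add_assoc, span_four_move_eq x y z w (hxy c₁ c₂) (hxy c₁' c₂'), hspan]
  have ht : IsRsopPart ![x, y, z, w] := isRsopPart_four hreg hdim hspan
  have ht' : IsRsopPart ![x, y, z', w'] := isRsopPart_four hreg hdim hspan'
  -- generic memberships in the frame `t′`
  have hxE : ∀ estar : Fin 4 → ℕ, estar 0 = 0 → x ∈ Ideal.span (uPow ![x, y, z', w'] '' {e | ¬ e ≤ estar}) := by
    intro estar h0
    have h := uPow_mem_span_uPow ![x, y, z', w'] (B := {e | ¬ e ≤ estar}) (b := Pi.single 0 1) (by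
      show ¬ _ ≤ _
      intro hle; have := hle 0; simp at this; omega)
    simpa [uPow_single] using h
  have hsqE : ∀ (estar : Fin 4 → ℕ) (l : Fin 4), estar l ≤ 1 →
      ![x, y, z', w'] l * ![x, y, z', w'] l ∈ Ideal.span (uPow ![x, y, z', w'] '' {e | ¬ e ≤ estar}) := by
    intro estar l hl
    have h := uPow_mem_span_uPow ![x, y, z', w'] (B := {e | ¬ e ≤ estar}) (b := Pi.single l 1 + Pi.single l 1) (by
      show ¬ _ ≤ _
      intro hle; have := hle l; simp at this; omega)
    rwa [uPow_add, uPow_single] at h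
  have hydE : ∀ estar : Fin 4 → ℕ, estar 1 ≤ d - 1 → 0 < d →
      y ^ d ∈ Ideal.span (uPow ![x, y, z', w'] '' {e | ¬ e ≤ estar}) := by
    intro estar h1 hd
    have h := uPow_mem_span_uPow ![x, y, z', w'] (B := {e | ¬ e ≤ estar}) (b := Pi.single 1 d) (by
      show ¬ _ ≤ _
      intro hle; have := hle 1; simp at this; omega)
    simpa [uPow_four] using h
  have hparE : ∀ (estar : Fin 4 → ℕ) (l : Fin 4), estar l = 0 →
      ![x, y, z', w'] l ∈ Ideal.span (uPow ![x, y, z', w'] '' {e | ¬ e ≤ estar}) := by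
    intro estar l hl
    have h := uPow_mem_span_uPow ![x, y, z', w'] (B := {e | ¬ e ≤ estar}) (b := Pi.single l 1) (by
      show ¬ _ ≤ _
      intro hle; have := hle l; simp at this; omega)
    rwa [uPow_single] at h
  -- the two first-order coefficients lie in `𝔪`
  have hA : eval ![-c₂, -c₂'] (pderiv 0 Ψ) ∈ maximalIdeal S := by
    have hst : ∀ e : Fin 4 → ℕ, e ≤ ![0, d - 1, 1, 0] → e 0 = 0 ∧ e 1 ≤ d - 1 ∧ e 2 + e 3 ≤ 1 := by
      intro e hle
      have h0 := hle 0; have h1 := hle 1; have h2 := hle 2; have h3' := hle 3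
      simp at h0 h1 h2 h3'; omega
    have hmem := eval_cone_mem_span_uPow_not_le ht ht' hspan hspan' h3 hΨ hfΨ hnear hfd' hB hst
    have := dir_pderiv_eval_mem_maximalIdeal ht' hspan' hΨ (estar := ![0, d - 1, 1, 0]) (p := z')
      (by rw [uPow_four]; simp) (hsqE _ 2 (by simp)) (hydE _ (by simp) (by omega)) ![1, 0] (z := z) (w := w)
      (c₂ := c₂) (c₂' := c₂') ?_ ?_ hmem
    · simpa using this
    · have : z - (-(c₂ * y) + z' * (![1, 0] : Fin 2 → S) 0) = -(c₁ * x) := by simp [hz']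
      rw [this]; exact neg_mem (Ideal.mul_mem_left _ _ (hxE _ (by simp)))
    · have : w - (-(c₂' * y) + z' * (![1, 0] : Fin 2 → S) 1) = w' - c₁' * x := by simp [hw']; ring
      rw [this]; exact sub_mem (hparE _ 3 (by simp)) (Ideal.mul_mem_left _ _ (hxE _ (by simp)))
  have hBc : eval ![-c₂, -c₂'] (pderiv 1 Ψ) ∈ maximalIdeal S := by
    have hst : ∀ e : Fin 4 → ℕ, e ≤ ![0, d - 1, 0, 1] → e 0 = 0 ∧ e 1 ≤ d - 1 ∧ e 2 + e 3 ≤ 1 := by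
      intro e hle
      have h0 := hle 0; have h1 := hle 1; have h2 := hle 2; have h3' := hle 3
      simp at h0 h1 h2 h3'; omega
    have hmem := eval_cone_mem_span_uPow_not_le ht ht' hspan hspan' h3 hΨ hfΨ hnear hfd' hB hst
    have := dir_pderiv_eval_mem_maximalIdeal ht' hspan' hΨ (estar := ![0, d - 1, 0, 1]) (p := w')
      (by rw [uPow_four]; simp) (hsqE _ 3 (by simp)) (hydE _ (by simp) (by omega)) ![0, 1] (z := z) (w := w)
      (c₂ := c₂) (c₂' := c₂') ?_ ?_ hmem
    · simpa using this
    · have : z - (-(c₂ * y) + w' * (![0, 1] : Fin 2 → S) 0) = z' - c₁ * x := by simp [hz']; ring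
      rw [this]; exact sub_mem (hparE _ 2 (by simp)) (Ideal.mul_mem_left _ _ (hxE _ (by simp)))
    · have : w - (-(c₂' * y) + w' * (![0, 1] : Fin 2 → S) 1) = -(c₁' * x) := by simp [hw']
      rw [this]; exact neg_mem (Ideal.mul_mem_left _ _ (hxE _ (by simp)))
  -- Euler: `Ψ(−c₂, −c₂′) ∈ 𝔪`
  have hΨm : eval ![-c₂, -c₂'] Ψ ∈ maximalIdeal S := by
    have heu := euler_eval hΨ ![-c₂, -c₂']
    have hd1 : (d : S) = 1 := by
      obtain ⟨k, rfl⟩ := hodd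
      have h2 : (2 : S) = 0 := by simpa using CharP.cast_eq_zero S 2
      push_cast; rw [h2]; ring
    rw [hd1, one_mul] at heu
    rw [← heu]
    exact add_mem (Ideal.mul_mem_left _ _ hA) (Ideal.mul_mem_left _ _ hBc)
  -- rootlessness
  have hres : eval ![residue S (-c₂), residue S (-c₂')] (MvPolynomial.map (residue S) Ψ) = 0 := by
    have := map_eval (residue S) ![-c₂, -c₂'] Ψ
    have hcomp : (residue S) ∘ ![-c₂, -c₂'] = ![residue S (-c₂), residue S (-c₂')] := by
      funext j; fin_cases j <;> rfl
    rw [hcomp] at this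
    rw [← this, residue_eq_zero_iff]
    exact hΨm
  by_contra hne
  have : residue S (-c₂) ≠ 0 ∨ residue S (-c₂') ≠ 0 := by
    by_contra h
    push Not at h
    apply hne
    constructor
    · have := (residue_eq_zero_iff _).mp h.1; simpa using this
    · have := (residue_eq_zero_iff _).mp h.2; simpa using this
  exact hroot _ _ this hres

end Summit.ResolutionOfSingularities.ResolutionOfSingularities.Theorems.SwitchingDichotomy.BetaNewton

end
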